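import Summits.AtomisticToContinuum.HydrodynamicLimit.Theorems.LambertianContactSwapLambertianEulerHearts
import HarnessLib

/-!
# The log-shell hearts and the packing-guarded clock statements of the Lambertian Euler limit (line `Sketch`, crux stmt-11854)

Support file (`--supports stmt-AtomisticToContinuum-11854`) of the line `Sketch` of the crux
`Summit.AtomisticToContinuum.HydrodynamicLimit.Theses.LambertianContactSwap.LambertianEuler`.  Lead c6 recorded the reduction
`KineticOneBlockInMeanLambda → CollisionalOneBlockInMeanLambda → ImplosionDichotomy.DiluteSelfConsistency → LambertianEuler`
(`…LambertianEulerHearts` / `…EstimateOfHearts` / `…OfHearts`).  Lead c7 reshapes its two open ends: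

* THE THIRD LEAF.  `DiluteSelfConsistency` (stmt-3091) is rated expected-false by its own chain (`DSC ↔ ¬DenseExcursion`,
  `Theorems/DenseExcursion/Negative/Dichotomy.lean`; the dense excursion is a tuned hard-sphere implosion), while the summit conjunct
  `_root_.HydrodynamicLimit` has been RE-TYPED with a packing guard `∀ t ∈ Ico 0 T, ∀ x, ρ t x * σ ^ 3 < η₀` (D-0032).  Every use of
  DSC in the line only manufactures such a guard for thresholds fixed before the data.  §3 therefore states the clock's intermediate
  statements GUARDED (`…InBand`: `∃ ηg > 0` after the insertion factor, the guard after the Euler solution — the hearts' own frame) and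
  §4 the guarded crux `LambertianEulerInBand` (the conjunct's shape for `Λ`), which the companion files derive from the two hearts with
  NO dilute self-consistency.
* THE SHELL.  The hearts' `∃ C, ∀ ε` is replaced by the LOG-SHELL `∀ κ > 0, ∃ ε₀ > 0, ∀ ε ∈ (0, ε₀), ∃ C, 0 ≤ C ≤ κ |log ε| ∧ …`
  (§1, `…Log`; implied by the old shell, `…Log_of`).  Reason: with the true kinetic energy the heat current is cubic, the entropy
  inequality must be applied to the current clamped at `|v − u| ≤ V(ε)`, and the admissible rate — hence `C` — degrades with `V(ε)`
  (Gaussian velocity tails give `C(ε) = O(√(log ε⁻¹)) = o(log ε⁻¹)`); the in-window bootstrap and the window Gronwall tolerate exactly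
  `C(ε) = o(log ε⁻¹)` (`exp (A t) ≤ ε^{-κ t}`), so nothing downstream is lost (`…EstimateOfHeartsLog`, `…OfHeartsInBand`).

Lead prover-line-stmt-AtomisticToContinuum-11854-c7-0, 2026-08-17.  [cite: Yau1991, §2] [cite: OllaVaradhanYau1993, §3–§4]
-/

noncomputable section

namespace Summit.AtomisticToContinuum.HydrodynamicLimit.Theorems.LambertianContactSwapLambertianEulerHeartsLog

open scoped BigOperators Topology ENNReal InnerProductSpace
open MeasureTheory ProbabilityTheory Filter Set InformationTheory
open Literature.MathematicalPhysics.KineticTheory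
open Literature.Analysis.FluidPDE Literature.Analysis.FluidPDE.Alexander
open Summit.AtomisticToContinuum.HydrodynamicLimit.Theorems.ClampedCurrentsDockPathwise (gSum DgSum)
open Summit.AtomisticToContinuum.HydrodynamicLimit.Theorems.LambertianContactSwapLambertianEulerHearts

/-! ## §1 The two research hearts in the log-shell -/

/-- For `0 < κ`, `0 < ε < 1/2` and `ε < exp (−C/κ)`: `C ≤ κ |log ε|`. [folklore] -/
theorem const_le_mul_abs_log : ∀ {C κ ε : ℝ}, 0 < κ → 0 < ε → ε < 1 / 2 → ε < Real.exp (-(C / κ)) → C ≤ κ * |Real.log ε| := by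
  intro C κ ε hκ hε hε2 hεC
  have hlog : Real.log ε < -(C / κ) := by
    have h := Real.log_lt_log hε hεC
    rwa [Real.log_exp] at h
  have hneg : Real.log ε < 0 := Real.log_neg hε (by linarith)
  rw [abs_of_neg hneg]
  have h1 : C / κ < -Real.log ε := by linarith
  have h2 : C < κ * -Real.log ε := by
    have := (div_lt_iff₀ hκ).1 h1
    linarith [this]
  exact h2.le

/-- **P3Λ-log — THE KINETIC HEART, log-shell** (research; registered stub `stub_kineticOneBlockInMeanLambdaLog` of crux stmt-11854,
line `Sketch`, lead c7's typing, v35). Same frame and functional as `KineticOneBlockInMeanLambda` (mean fast kinetic current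
`−E_λ[∫_s^{s′} Σ_i Y⊥_r dr]` along the Lambertian flow, one-sided, first-moment, on arbitrary sub-intervals of `[0,t]`, entropy
allowance `C (s′−s) M`), with the constant allowed to grow slowly as the tolerance shrinks: for every `κ > 0` there is `ε₀ > 0` such
that for every `ε ∈ (0, ε₀)` some `C` with `0 ≤ C ≤ κ |log ε|` works eventually in `N`.  This is the shell the relative-entropy method
with a clamped cubic current delivers (rate `∝ 1/V(ε)`, Gaussian tails: `C = O(√(log ε⁻¹))`), and the one the window Gronwall consumes.
OPEN — a research statement of this line, not a published fact. -/
def KineticOneBlockInMeanLambdaLog : Prop :=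
  ∀ (r : ℝ) (Rf : ℝ → ℝ), 0 < r →
      (∀ x ∈ Set.Ioo (-r) r, 0 < Rf x ∧ Rf x * (∑' j : ℕ, bE j / (j.factorial : ℝ) * (x * Rf x) ^ j) = 1) →
      (∀ x ∈ Set.Icc 0 r, 1 ≤ Rf x ∧ Rf x ≤ 2) → ContinuousOn Rf (Set.Icc 0 r) →
      (∀ x ∈ Set.Ioo (-r) r, ∀ R ∈ Set.Icc (1 / 2 : ℝ) 2,
        R * (∑' j : ℕ, bE j / (j.factorial : ℝ) * (x * R) ^ j) = 1 → R = Rf x) →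
    ∃ ηh : ℝ, 0 < ηh ∧ ∀ (a₀ θ₀ : T3 → ℝ) (u₀ : T3 → V3), Continuous a₀ → Continuous θ₀ → Continuous u₀ →
      (∀ x, 0 < a₀ x) → (∀ x, 0 < θ₀ x) →
      ∃ σ₀ : ℝ, 0 < σ₀ ∧ ∀ σ : ℝ, 0 < σ → σ < σ₀ →
        ∀ (T : ℝ) (ρ θ : ℝ → T3 → ℝ) (u : ℝ → T3 → V3), IsHardSphereEulerSolution σ T ρ u θ →
          (∀ t ∈ Set.Ico 0 T, ∀ x, ρ t x * σ ^ 3 < ηh) →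
          ∀ Φ : (N : ℕ) → HardSphereFlow (Torus.geometry (Fin 3)) (hsDiameter σ N) (N + 1),
            TendstoHydroFieldsAt (fun N => localGibbsLaw σ a₀ u₀ θ₀ N (Φ N)) Φ ρ u θ 0 →
            ∀ t ∈ Set.Ioo 0 T, ∀ κ : ℝ, 0 < κ → ∃ ε₀ : ℝ, 0 < ε₀ ∧ ∀ ε : ℝ, 0 < ε → ε < ε₀ →
              ∃ C : ℝ, 0 ≤ C ∧ C ≤ κ * |Real.log ε| ∧ ∃ N₀ : ℕ, ∀ N : ℕ, N₀ ≤ N →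
              ∀ (s s' M : ℝ), 0 ≤ s → s ≤ s' → s' ≤ t →
                (∀ r' ∈ Set.Icc s s', Hent σ a₀ θ₀ u₀ Rf ρ θ u N (Φ N) r' ≤ M) →
                -(Yint σ a₀ θ₀ u₀ θ u N (Φ N) s s') ≤ C * (s' - s) * M + ε * ((N : ℝ) + 1)

/-- **P4Λ-log — THE COLLISIONAL HEART, log-shell** (research; registered stub `stub_collisionalOneBlockInMeanLambdaLog` of crux
stmt-11854, line `Sketch`, lead c7's typing, v35). Same frame and functional as `CollisionalOneBlockInMeanLambda` (cosine-compensated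
collisional transfer of `Σ_i g` minus its one-body linear response `X` plus the statics `Δ log Zpos`, with entropy allowance), in the
log-shell `∀ κ > 0, ∃ ε₀ > 0, ∀ ε ∈ (0, ε₀), ∃ C, 0 ≤ C ≤ κ |log ε| ∧ …` (the compensated jumps are cubic in the velocities through
`|g| (c − u)`, so the same clamp-and-rate bookkeeping applies).  OPEN — a research statement of this line, not a published fact. -/
def CollisionalOneBlockInMeanLambdaLog : Prop :=
  ∀ (r : ℝ) (Rf : ℝ → ℝ), 0 < r →
      (∀ x ∈ Set.Ioo (-r) r, 0 < Rf x ∧ Rf x * (∑' j : ℕ, bE j / (j.factorial : ℝ) * (x * Rf x) ^ j) = 1) →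
      (∀ x ∈ Set.Icc 0 r, 1 ≤ Rf x ∧ Rf x ≤ 2) → ContinuousOn Rf (Set.Icc 0 r) →
      (∀ x ∈ Set.Ioo (-r) r, ∀ R ∈ Set.Icc (1 / 2 : ℝ) 2,
        R * (∑' j : ℕ, bE j / (j.factorial : ℝ) * (x * R) ^ j) = 1 → R = Rf x) →
    ∃ ηh : ℝ, 0 < ηh ∧ ∀ (a₀ θ₀ : T3 → ℝ) (u₀ : T3 → V3), Continuous a₀ → Continuous θ₀ → Continuous u₀ →
      (∀ x, 0 < a₀ x) → (∀ x, 0 < θ₀ x) →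
      ∃ σ₀ : ℝ, 0 < σ₀ ∧ ∀ σ : ℝ, 0 < σ → σ < σ₀ →
        ∀ (T : ℝ) (ρ θ : ℝ → T3 → ℝ) (u : ℝ → T3 → V3), IsHardSphereEulerSolution σ T ρ u θ →
          (∀ t ∈ Set.Ico 0 T, ∀ x, ρ t x * σ ^ 3 < ηh) →
          ∀ Φ : (N : ℕ) → HardSphereFlow (Torus.geometry (Fin 3)) (hsDiameter σ N) (N + 1),
            TendstoHydroFieldsAt (fun N => localGibbsLaw σ a₀ u₀ θ₀ N (Φ N)) Φ ρ u θ 0 →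
            ∀ t ∈ Set.Ioo 0 T, ∀ κ : ℝ, 0 < κ → ∃ ε₀ : ℝ, 0 < ε₀ ∧ ∀ ε : ℝ, 0 < ε → ε < ε₀ →
              ∃ C : ℝ, 0 ≤ C ∧ C ≤ κ * |Real.log ε| ∧ ∃ N₀ : ℕ, ∀ N : ℕ, N₀ ≤ N →
              ∀ (s s' M : ℝ), 0 ≤ s → s ≤ s' → s' ≤ t →
                (∀ r' ∈ Set.Icc s s', Hent σ a₀ θ₀ u₀ Rf ρ θ u N (Φ N) r' ≤ M) →
                -(Jmp σ a₀ θ₀ u₀ Rf ρ θ u N (Φ N) s s') + Xint σ a₀ θ₀ u₀ ρ θ u N (Φ N) s s' +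
                    dLZ σ Rf ρ N s s' ≤ C * (s' - s) * M + ε * ((N : ℝ) + 1)

/-- The old shell implies the log-shell: a constant `C` satisfies `C ≤ κ |log ε|` once `ε < exp (−C/κ)`. [folklore] -/
theorem kineticOneBlockInMeanLambdaLog_of (h : KineticOneBlockInMeanLambda) : KineticOneBlockInMeanLambdaLog := by
  intro r Rf hr hsol hbd hcont huniq
  obtain ⟨ηh, hηh, H⟩ := h r Rf hr hsol hbd hcont huniq
  refine ⟨ηh, hηh, fun a₀ θ₀ u₀ ha hθ hu ha0 hθ0 => ?_⟩
  obtain ⟨σ₀, hσ₀, H⟩ := H a₀ θ₀ u₀ ha hθ hu ha0 hθ0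
  refine ⟨σ₀, hσ₀, fun σ hσ hσ' T ρ θ u hE hg Φ htie t ht κ hκ => ?_⟩
  obtain ⟨C, hC, HC⟩ := H σ hσ hσ' T ρ θ u hE hg Φ htie t ht
  refine ⟨min (1 / 2) (Real.exp (-(C / κ))), lt_min (by norm_num) (Real.exp_pos _), fun ε hε hεlt => ?_⟩
  refine ⟨C, hC, ?_, HC ε hε⟩
  exact const_le_mul_abs_log hκ hε (hεlt.trans_le (min_le_left _ _)) (hεlt.trans_le (min_le_right _ _))

/-- The old shell implies the log-shell (collisional heart). [folklore] -/
theorem collisionalOneBlockInMeanLambdaLog_of (h : CollisionalOneBlockInMeanLambda) : CollisionalOneBlockInMeanLambdaLog := by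
  intro r Rf hr hsol hbd hcont huniq
  obtain ⟨ηh, hηh, H⟩ := h r Rf hr hsol hbd hcont huniq
  refine ⟨ηh, hηh, fun a₀ θ₀ u₀ ha hθ hu ha0 hθ0 => ?_⟩
  obtain ⟨σ₀, hσ₀, H⟩ := H a₀ θ₀ u₀ ha hθ hu ha0 hθ0
  refine ⟨σ₀, hσ₀, fun σ hσ hσ' T ρ θ u hE hg Φ htie t ht κ hκ => ?_⟩
  obtain ⟨C, hC, HC⟩ := H σ hσ hσ' T ρ θ u hE hg Φ htie t ht
  refine ⟨min (1 / 2) (Real.exp (-(C / κ))), lt_min (by norm_num) (Real.exp_pos _), fun ε hε hεlt => ?_⟩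
  refine ⟨C, hC, ?_, HC ε hε⟩
  exact const_le_mul_abs_log hκ hε (hεlt.trans_le (min_le_left _ _)) (hεlt.trans_le (min_le_right _ _))

/-- The named log-shell kinetic heart IS the registered expanded stub signature `stub_kineticOneBlockInMeanLambdaLog`
(definitional unfolding of `Hent`, `Yint`). -/
theorem kineticOneBlockInMeanLambdaLog_iff :
    KineticOneBlockInMeanLambdaLog ↔
    (    ∀ (r : ℝ) (Rf : ℝ → ℝ), 0 < r →
      (∀ x ∈ Set.Ioo (-r) r, 0 < Rf x ∧ Rf x * (∑' j : ℕ, bE j / (j.factorial : ℝ) * (x * Rf x) ^ j) = 1) →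
      (∀ x ∈ Set.Icc 0 r, 1 ≤ Rf x ∧ Rf x ≤ 2) → ContinuousOn Rf (Set.Icc 0 r) →
      (∀ x ∈ Set.Ioo (-r) r, ∀ R ∈ Set.Icc (1 / 2 : ℝ) 2,
        R * (∑' j : ℕ, bE j / (j.factorial : ℝ) * (x * R) ^ j) = 1 → R = Rf x) →
    ∃ ηh : ℝ, 0 < ηh ∧ ∀ (a₀ θ₀ : T3 → ℝ) (u₀ : T3 → V3), Continuous a₀ → Continuous θ₀ → Continuous u₀ →
      (∀ x, 0 < a₀ x) → (∀ x, 0 < θ₀ x) →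
      ∃ σ₀ : ℝ, 0 < σ₀ ∧ ∀ σ : ℝ, 0 < σ → σ < σ₀ →
        ∀ (T : ℝ) (ρ θ : ℝ → T3 → ℝ) (u : ℝ → T3 → V3), IsHardSphereEulerSolution σ T ρ u θ →
          (∀ t ∈ Set.Ico 0 T, ∀ x, ρ t x * σ ^ 3 < ηh) →
          ∀ Φ : (N : ℕ) → HardSphereFlow (Torus.geometry (Fin 3)) (hsDiameter σ N) (N + 1),
            TendstoHydroFieldsAt (fun N => localGibbsLaw σ a₀ u₀ θ₀ N (Φ N)) Φ ρ u θ 0 →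
            ∀ t ∈ Set.Ioo 0 T, ∀ κ : ℝ, 0 < κ → ∃ ε₀ : ℝ, 0 < ε₀ ∧ ∀ ε : ℝ, 0 < ε → ε < ε₀ →
              ∃ C : ℝ, 0 ≤ C ∧ C ≤ κ * |Real.log ε| ∧ ∃ N₀ : ℕ, ∀ N : ℕ, N₀ ≤ N →
              ∀ (s s' M : ℝ), 0 ≤ s → s ≤ s' → s' ≤ t →
                (∀ r' ∈ Set.Icc s s',
                  (klDiv (((localGibbsLaw σ a₀ u₀ θ₀ N (Φ N)).prod (lambertNoise (Fin 3))).map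
        (fun p => lambertFlow (Torus.geometry (Fin 3)) (hsDiameter σ N) p.2 p.1 r'))
      (localGibbsLaw σ (fun x => ρ r' x * Rf (σ ^ 3 * ρ r' x)) (u r') (θ r') N (Φ N))).toReal ≤ M) →
                -(∫ p, (∫ r in s..s', ∑ i : Fin (N + 1), ((θ r (lambertFlow (Torus.geometry (Fin 3)) (hsDiameter σ N) p.2 p.1 r i).1)⁻¹ * ∑ j : Fin 3, ∑ k : Fin 3, (((lambertFlow (Torus.geometry (Fin 3)) (hsDiameter σ N) p.2 p.1 r i).2 - u r (lambertFlow (Torus.geometry (Fin 3)) (hsDiameter σ N) p.2 p.1 r i).1) j * ((lambertFlow (Torus.geometry (Fin 3)) (hsDiameter σ N) p.2 p.1 r i).2 - u r (lambertFlow (Torus.geometry (Fin 3)) (hsDiameter σ N) p.2 p.1 r i).1) k - (if j = k then ‖(lambertFlow (Torus.geometry (Fin 3)) (hsDiameter σ N) p.2 p.1 r i).2 - u r (lambertFlow (Torus.geometry (Fin 3)) (hsDiameter σ N) p.2 p.1 r i).1‖ ^ 2 / 3 else 0)) * Literature.Analysis.FunctionSpaces.Torus.partialDeriv k (fun y =>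 u r y j) (lambertFlow (Torus.geometry (Fin 3)) (hsDiameter σ N) p.2 p.1 r i).1 + (‖(lambertFlow (Torus.geometry (Fin 3)) (hsDiameter σ N) p.2 p.1 r i).2 - u r (lambertFlow (Torus.geometry (Fin 3)) (hsDiameter σ N) p.2 p.1 r i).1‖ ^ 2 - 5 * θ r (lambertFlow (Torus.geometry (Fin 3)) (hsDiameter σ N) p.2 p.1 r i).1) * (∑ k : Fin 3, ((lambertFlow (Torus.geometry (Fin 3)) (hsDiameter σ N) p.2 p.1 r i).2 - u r (lambertFlow (Torus.geometry (Fin 3)) (hsDiameter σ N) p.2 p.1 r i).1) k * Literature.Analysis.FunctionSpaces.Torus.partialDeriv k (θ r) (lambertFlow (Torus.geometry (Fin 3)) (hsDiameter σ N) p.2 p.1 r i).1) / (2 * (θ r (lambertFlow (Torus.geometry (Fin 3)) (hsDiameter σ N) p.2 p.1 r i).1) ^ 2))) ∂((localGibbsLaw σ a₀ u₀ θ₀ N (Φ N)).prod (lambertNoise (Fin 3)))) ≤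
                  C * (s' - s) * M + ε * ((N : ℝ) + 1)) :=
  Iff.rfl

/-- The named log-shell collisional heart IS the registered expanded stub signature `stub_collisionalOneBlockInMeanLambdaLog`
(definitional unfolding of `Hent`, `Jmp`, `Xint`, `dLZ`). -/
theorem collisionalOneBlockInMeanLambdaLog_iff :
    CollisionalOneBlockInMeanLambdaLog ↔
    (    ∀ (r : ℝ) (Rf : ℝ → ℝ), 0 < r →
      (∀ x ∈ Set.Ioo (-r) r, 0 < Rf x ∧ Rf x * (∑' j : ℕ, bE j / (j.factorial : ℝ) * (x * Rf x) ^ j) = 1) →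
      (∀ x ∈ Set.Icc 0 r, 1 ≤ Rf x ∧ Rf x ≤ 2) → ContinuousOn Rf (Set.Icc 0 r) →
      (∀ x ∈ Set.Ioo (-r) r, ∀ R ∈ Set.Icc (1 / 2 : ℝ) 2,
        R * (∑' j : ℕ, bE j / (j.factorial : ℝ) * (x * R) ^ j) = 1 → R = Rf x) →
    ∃ ηh : ℝ, 0 < ηh ∧ ∀ (a₀ θ₀ : T3 → ℝ) (u₀ : T3 → V3), Continuous a₀ → Continuous θ₀ → Continuous u₀ →
      (∀ x, 0 < a₀ x) → (∀ x, 0 < θ₀ x) →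
      ∃ σ₀ : ℝ, 0 < σ₀ ∧ ∀ σ : ℝ, 0 < σ → σ < σ₀ →
        ∀ (T : ℝ) (ρ θ : ℝ → T3 → ℝ) (u : ℝ → T3 → V3), IsHardSphereEulerSolution σ T ρ u θ →
          (∀ t ∈ Set.Ico 0 T, ∀ x, ρ t x * σ ^ 3 < ηh) →
          ∀ Φ : (N : ℕ) → HardSphereFlow (Torus.geometry (Fin 3)) (hsDiameter σ N) (N + 1),
            TendstoHydroFieldsAt (fun N => localGibbsLaw σ a₀ u₀ θ₀ N (Φ N)) Φ ρ u θ 0 →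
            ∀ t ∈ Set.Ioo 0 T, ∀ κ : ℝ, 0 < κ → ∃ ε₀ : ℝ, 0 < ε₀ ∧ ∀ ε : ℝ, 0 < ε → ε < ε₀ →
              ∃ C : ℝ, 0 ≤ C ∧ C ≤ κ * |Real.log ε| ∧ ∃ N₀ : ℕ, ∀ N : ℕ, N₀ ≤ N →
              ∀ (s s' M : ℝ), 0 ≤ s → s ≤ s' → s' ≤ t →
                (∀ r' ∈ Set.Icc s s',
                  (klDiv (((localGibbsLaw σ a₀ u₀ θ₀ N (Φ N)).prod (lambertNoise (Fin 3))).map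
        (fun p => lambertFlow (Torus.geometry (Fin 3)) (hsDiameter σ N) p.2 p.1 r'))
      (localGibbsLaw σ (fun x => ρ r' x * Rf (σ ^ 3 * ρ r' x)) (u r') (θ r') N (Φ N))).toReal ≤ M) →
                -(∫ p, (∑ m ∈ Finset.range (lambertCount (Torus.geometry (Fin 3)) (hsDiameter σ N) p.2 p.1 s'),
        if s < (lambertInstant (Torus.geometry (Fin 3)) (hsDiameter σ N) p.2 p.1 (m + 1)).toReal then
          (∫ ξ, gSum (fun r x => ρ r x * Rf (σ ^ 3 * ρ r x)) θ u (lambertInstant (Torus.geometry (Fin 3)) (hsDiameter σ N) p.2 p.1 (m + 1)).toReal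
              (lambertStepMap (Torus.geometry (Fin 3)) (incomingPairs (Torus.geometry (Fin 3)) (hsDiameter σ N)
                (freeFlight (Torus.geometry (Fin 3)) (freeExitTime (Torus.geometry (Fin 3)) (hsDiameter σ N) (lambertStateAfter (Torus.geometry (Fin 3)) (hsDiameter σ N) p.2 p.1 m)).toReal (lambertStateAfter (Torus.geometry (Fin 3)) (hsDiameter σ N) p.2 p.1 m)))
                (freeFlight (Torus.geometry (Fin 3)) (freeExitTime (Torus.geometry (Fin 3)) (hsDiameter σ N) (lambertStateAfter (Torus.geometry (Fin 3)) (hsDiameter σ N) p.2 p.1 m)).toReal (lambertStateAfter (Torus.geometry (Fin 3)) (hsDiameter σ N) p.2 p.1 m)) ξ) ∂(stdGaussian V3)) -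
            gSum (fun r x => ρ r x * Rf (σ ^ 3 * ρ r x)) θ u (lambertInstant (Torus.geometry (Fin 3)) (hsDiameter σ N) p.2 p.1 (m + 1)).toReal
              (freeFlight (Torus.geometry (Fin 3)) (freeExitTime (Torus.geometry (Fin 3)) (hsDiameter σ N) (lambertStateAfter (Torus.geometry (Fin 3)) (hsDiameter σ N) p.2 p.1 m)).toReal (lambertStateAfter (Torus.geometry (Fin 3)) (hsDiameter σ N) p.2 p.1 m))
        else 0) ∂((localGibbsLaw σ a₀ u₀ θ₀ N (Φ N)).prod (lambertNoise (Fin 3)))) +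
                    (∫ p, (∫ r in s..s', ∑ i : Fin (N + 1), ((∑ k : Fin 3, Literature.Analysis.FunctionSpaces.Torus.partialDeriv k (fun y => u r y k / θ r y) (lambertFlow (Torus.geometry (Fin 3)) (hsDiameter σ N) p.2 p.1 r i).1) * (θ r (lambertFlow (Torus.geometry (Fin 3)) (hsDiameter σ N) p.2 p.1 r i).1 * (ρ r (lambertFlow (Torus.geometry (Fin 3)) (hsDiameter σ N) p.2 p.1 r i).1 * σ ^ 3) * deriv hsCompressibility (ρ r (lambertFlow (Torus.geometry (Fin 3)) (hsDiameter σ N) p.2 p.1 r i).1 * σ ^ 3) + (1 / 3) * (hsCompressibility (ρ r (lambertFlow (Torus.geometry (Fin 3)) (hsDiameter σ N) p.2 p.1 r i).1 * σ ^ 3) - 1) * ‖(lambertFlow (Torus.geometry (Fin 3)) (hsDiameter σ N) p.2 p.1 r i).2 - u r (lambertFlow (Torus.geometry (Fin 3)) (hsDiameter σ N) p.2 p.1 r i).1‖ ^ 2) + ((∑ k : Fin 3, u r (lambertFlow (Torus.geometry (Fin 3)) (hsDiameter σ N) p.2 p.1 r i).1 k * Literature.Analysis.FunctionSpaces.Torus.partialDeriv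 k (θ r) (lambertFlow (Torus.geometry (Fin 3)) (hsDiameter σ N) p.2 p.1 r i).1) / (θ r (lambertFlow (Torus.geometry (Fin 3)) (hsDiameter σ N) p.2 p.1 r i).1) ^ 2) * (θ r (lambertFlow (Torus.geometry (Fin 3)) (hsDiameter σ N) p.2 p.1 r i).1 * (ρ r (lambertFlow (Torus.geometry (Fin 3)) (hsDiameter σ N) p.2 p.1 r i).1 * σ ^ 3) * deriv hsCompressibility (ρ r (lambertFlow (Torus.geometry (Fin 3)) (hsDiameter σ N) p.2 p.1 r i).1 * σ ^ 3) + (1 / 3) * (hsCompressibility (ρ r (lambertFlow (Torus.geometry (Fin 3)) (hsDiameter σ N) p.2 p.1 r i).1 * σ ^ 3) - 1) * ‖(lambertFlow (Torus.geometry (Fin 3)) (hsDiameter σ N) p.2 p.1 r i).2 - u r (lambertFlow (Torus.geometry (Fin 3)) (hsDiameter σ N) p.2 p.1 r i).1‖ ^ 2) + (hsCompressibility (ρ r (lambertFlow (Torus.geometry (Fin 3)) (hsDiameter σ N) p.2 p.1 r i).1 * σ ^ 3) - 1) * (∑ k : Fin 3, ((lambertFlow (Torus.geometry (Fin 3)) (hsDiameter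 σ N) p.2 p.1 r i).2 - u r (lambertFlow (Torus.geometry (Fin 3)) (hsDiameter σ N) p.2 p.1 r i).1) k * Literature.Analysis.FunctionSpaces.Torus.partialDeriv k (θ r) (lambertFlow (Torus.geometry (Fin 3)) (hsDiameter σ N) p.2 p.1 r i).1) / θ r (lambertFlow (Torus.geometry (Fin 3)) (hsDiameter σ N) p.2 p.1 r i).1)) ∂((localGibbsLaw σ a₀ u₀ θ₀ N (Φ N)).prod (lambertNoise (Fin 3)))) +
                    (Real.log (posPartition (fun x => ρ s' x * Rf (σ ^ 3 * ρ s' x)) (hsDiameter σ N) (N + 1)) -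
        Real.log (posPartition (fun x => ρ s x * Rf (σ ^ 3 * ρ s x)) (hsDiameter σ N) (N + 1))) ≤
                  C * (s' - s) * M + ε * ((N : ℝ) + 1)) :=
  Iff.rfl

/-! ## §3 The clock's intermediate statements, packing-guarded and in the log-shell -/

/-- **ESTIMATE, guarded, log-shell** — Yau's one-window production estimate for `Λ` on the explicit functional
`Δ log Zpos − E_λ[∫ΣDg] − E_λ[Σ compensated jumps]` along `a_r = ρ_r·Rf(σ³ρ_r)`, for Euler solutions whose packing stays below a band
`ηg` fixed after the insertion factor and before the data: for every `κ > 0`, for all small `ε`, a rate `A ≤ κ |log ε|` and windows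
`w_N` with `≤ A w H_N(s) + w (N+1) ε` on full windows of `[0,t]` and `≤ (N+1) ε` on the last partial window (derived from the log-hearts
in `…EstimateOfHeartsLog`, with no dilute self-consistency). -/
def WindowProductionEstimateLambdaInBand : Prop :=
  ∀ (r : ℝ) (Rf : ℝ → ℝ), 0 < r →
      (∀ x ∈ Set.Ioo (-r) r, 0 < Rf x ∧ Rf x * (∑' j : ℕ, bE j / (j.factorial : ℝ) * (x * Rf x) ^ j) = 1) →
      (∀ x ∈ Set.Icc 0 r, 1 ≤ Rf x ∧ Rf x ≤ 2) → ContinuousOn Rf (Set.Icc 0 r) →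
      (∀ x ∈ Set.Ioo (-r) r, ∀ R ∈ Set.Icc (1 / 2 : ℝ) 2,
        R * (∑' j : ℕ, bE j / (j.factorial : ℝ) * (x * R) ^ j) = 1 → R = Rf x) →
    ∃ ηg : ℝ, 0 < ηg ∧ ∀ (a₀ θ₀ : T3 → ℝ) (u₀ : T3 → V3), Continuous a₀ → Continuous θ₀ → Continuous u₀ →
      (∀ x, 0 < a₀ x) → (∀ x, 0 < θ₀ x) →
      ∃ σ₀ : ℝ, 0 < σ₀ ∧ ∀ σ : ℝ, 0 < σ → σ < σ₀ →
        ∀ (T : ℝ) (ρ θ : ℝ → T3 → ℝ) (u : ℝ → T3 → V3), IsHardSphereEulerSolution σ T ρ u θ →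
          (∀ t ∈ Set.Ico 0 T, ∀ x, ρ t x * σ ^ 3 < ηg) →
          ∀ Φ : (N : ℕ) → HardSphereFlow (Torus.geometry (Fin 3)) (hsDiameter σ N) (N + 1),
            TendstoHydroFieldsAt (fun N => localGibbsLaw σ a₀ u₀ θ₀ N (Φ N)) Φ ρ u θ 0 →
            ∀ t ∈ Set.Ioo 0 T,
              ∀ κ : ℝ, 0 < κ → ∃ ε₀ : ℝ, 0 < ε₀ ∧ ∀ ε : ℝ, 0 < ε → ε < ε₀ →
                ∃ A : ℝ, 0 ≤ A ∧ A ≤ κ * |Real.log ε| ∧ ∃ w : ℕ → ℝ, (∀ N, 0 < w N) ∧ ∃ N₀ : ℕ, ∀ N : ℕ, N₀ ≤ N →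
                (∀ s : ℝ, 0 ≤ s → s + w N ≤ t →
                  dLZ σ Rf ρ N s (s + w N) - Sint σ a₀ θ₀ u₀ Rf ρ θ u T N (Φ N) s (s + w N) -
                      Jmp σ a₀ θ₀ u₀ Rf ρ θ u N (Φ N) s (s + w N) ≤
                    A * w N * Hent σ a₀ θ₀ u₀ Rf ρ θ u N (Φ N) s + w N * ((N : ℝ) + 1) * ε) ∧
                (∀ s : ℝ, 0 ≤ s → s ≤ t → t ≤ s + w N →
                  dLZ σ Rf ρ N s t - Sint σ a₀ θ₀ u₀ Rf ρ θ u T N (Φ N) s t - Jmp σ a₀ θ₀ u₀ Rf ρ θ u N (Φ N) s t ≤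
                    ((N : ℝ) + 1) * ε)

/-- **BOUND, guarded, log-shell** — the expected entropy production over one window along the explicit reference family obeys the
same bounds (ESTIMATE through the FORMULA p128635). -/
def WindowProductionBoundLambdaInBand : Prop :=
  ∀ (r : ℝ) (Rf : ℝ → ℝ), 0 < r →
      (∀ x ∈ Set.Ioo (-r) r, 0 < Rf x ∧ Rf x * (∑' j : ℕ, bE j / (j.factorial : ℝ) * (x * Rf x) ^ j) = 1) →
      (∀ x ∈ Set.Icc 0 r, 1 ≤ Rf x ∧ Rf x ≤ 2) → ContinuousOn Rf (Set.Icc 0 r) →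
      (∀ x ∈ Set.Ioo (-r) r, ∀ R ∈ Set.Icc (1 / 2 : ℝ) 2,
        R * (∑' j : ℕ, bE j / (j.factorial : ℝ) * (x * R) ^ j) = 1 → R = Rf x) →
    ∃ ηg : ℝ, 0 < ηg ∧ ∀ (a₀ θ₀ : T3 → ℝ) (u₀ : T3 → V3), Continuous a₀ → Continuous θ₀ → Continuous u₀ →
      (∀ x, 0 < a₀ x) → (∀ x, 0 < θ₀ x) →
      ∃ σ₀ : ℝ, 0 < σ₀ ∧ ∀ σ : ℝ, 0 < σ → σ < σ₀ →
        ∀ (T : ℝ) (ρ θ : ℝ → T3 → ℝ) (u : ℝ → T3 → V3), IsHardSphereEulerSolution σ T ρ u θ →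
          (∀ t ∈ Set.Ico 0 T, ∀ x, ρ t x * σ ^ 3 < ηg) →
          ∀ Φ : (N : ℕ) → HardSphereFlow (Torus.geometry (Fin 3)) (hsDiameter σ N) (N + 1),
            TendstoHydroFieldsAt (fun N => localGibbsLaw σ a₀ u₀ θ₀ N (Φ N)) Φ ρ u θ 0 →
            ∀ t ∈ Set.Ioo 0 T,
              ∀ κ : ℝ, 0 < κ → ∃ ε₀ : ℝ, 0 < ε₀ ∧ ∀ ε : ℝ, 0 < ε → ε < ε₀ →
                ∃ A : ℝ, 0 ≤ A ∧ A ≤ κ * |Real.log ε| ∧ ∃ w : ℕ → ℝ, (∀ N, 0 < w N) ∧ ∃ N₀ : ℕ, ∀ N : ℕ, N₀ ≤ N →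
                (∀ s : ℝ, 0 ≤ s → s + w N ≤ t →
                  ∫ q, (Real.log (canonicalDensity (Torus.geometry (Fin 3)) (hsDiameter σ N) (N + 1)
                    (localGibbsProfile (fun x => ρ s x * Rf (σ ^ 3 * ρ s x)) (u s) (θ s)) q.1) -
                      Real.log (canonicalDensity (Torus.geometry (Fin 3)) (hsDiameter σ N) (N + 1)
                    (localGibbsProfile (fun x => ρ (s + w N) x * Rf (σ ^ 3 * ρ (s + w N) x)) (u (s + w N)) (θ (s + w N)))
                        (lambertFlow (Torus.geometry (Fin 3)) (hsDiameter σ N) q.2 q.1 (w N))))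
                    ∂(((((localGibbsLaw σ a₀ u₀ θ₀ N (Φ N)).prod (lambertNoise (Fin 3))).map
                      (fun p => lambertFlow (Torus.geometry (Fin 3)) (hsDiameter σ N) p.2 p.1 s))).prod (lambertNoise (Fin 3))) ≤
                  A * w N * Hent σ a₀ θ₀ u₀ Rf ρ θ u N (Φ N) s + w N * ((N : ℝ) + 1) * ε) ∧
                (∀ s : ℝ, 0 ≤ s → s ≤ t → t ≤ s + w N →
                  ∫ q, (Real.log (canonicalDensity (Torus.geometry (Fin 3)) (hsDiameter σ N) (N + 1)
                    (localGibbsProfile (fun x => ρ s x * Rf (σ ^ 3 * ρ s x)) (u s) (θ s)) q.1) -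
                      Real.log (canonicalDensity (Torus.geometry (Fin 3)) (hsDiameter σ N) (N + 1)
                    (localGibbsProfile (fun x => ρ t x * Rf (σ ^ 3 * ρ t x)) (u t) (θ t))
                        (lambertFlow (Torus.geometry (Fin 3)) (hsDiameter σ N) q.2 q.1 (t - s))))
                    ∂(((((localGibbsLaw σ a₀ u₀ θ₀ N (Φ N)).prod (lambertNoise (Fin 3))).map
                      (fun p => lambertFlow (Torus.geometry (Fin 3)) (hsDiameter σ N) p.2 p.1 s))).prod (lambertNoise (Fin 3))) ≤ ((N : ℝ) + 1) * ε)

/-- **WINDOW STEP, guarded, log-shell** — `H_N(s + w) ≤ (1 + A w) H_N(s) + w (N+1) ε` over full windows and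
`H_N(t) ≤ H_N(s) + (N+1) ε` on the last partial one, `A ≤ κ |log ε|` (BOUND through the one-window ledger p122335). -/
def WindowStepLambdaInBand : Prop :=
  ∀ (r : ℝ) (Rf : ℝ → ℝ), 0 < r →
      (∀ x ∈ Set.Ioo (-r) r, 0 < Rf x ∧ Rf x * (∑' j : ℕ, bE j / (j.factorial : ℝ) * (x * Rf x) ^ j) = 1) →
      (∀ x ∈ Set.Icc 0 r, 1 ≤ Rf x ∧ Rf x ≤ 2) → ContinuousOn Rf (Set.Icc 0 r) →
      (∀ x ∈ Set.Ioo (-r) r, ∀ R ∈ Set.Icc (1 / 2 : ℝ) 2,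
        R * (∑' j : ℕ, bE j / (j.factorial : ℝ) * (x * R) ^ j) = 1 → R = Rf x) →
    ∃ ηg : ℝ, 0 < ηg ∧ ∀ (a₀ θ₀ : T3 → ℝ) (u₀ : T3 → V3), Continuous a₀ → Continuous θ₀ → Continuous u₀ →
      (∀ x, 0 < a₀ x) → (∀ x, 0 < θ₀ x) →
      ∃ σ₀ : ℝ, 0 < σ₀ ∧ ∀ σ : ℝ, 0 < σ → σ < σ₀ →
        ∀ (T : ℝ) (ρ θ : ℝ → T3 → ℝ) (u : ℝ → T3 → V3), IsHardSphereEulerSolution σ T ρ u θ →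
          (∀ t ∈ Set.Ico 0 T, ∀ x, ρ t x * σ ^ 3 < ηg) →
          ∀ Φ : (N : ℕ) → HardSphereFlow (Torus.geometry (Fin 3)) (hsDiameter σ N) (N + 1),
            TendstoHydroFieldsAt (fun N => localGibbsLaw σ a₀ u₀ θ₀ N (Φ N)) Φ ρ u θ 0 →
            ∀ t ∈ Set.Ioo 0 T,
              ∀ κ : ℝ, 0 < κ → ∃ ε₀ : ℝ, 0 < ε₀ ∧ ∀ ε : ℝ, 0 < ε → ε < ε₀ →
                ∃ A : ℝ, 0 ≤ A ∧ A ≤ κ * |Real.log ε| ∧ ∃ w : ℕ → ℝ, (∀ N, 0 < w N) ∧ ∃ N₀ : ℕ, ∀ N : ℕ, N₀ ≤ N →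
                (∀ s : ℝ, 0 ≤ s → s + w N ≤ t →
                  Hent σ a₀ θ₀ u₀ Rf ρ θ u N (Φ N) (s + w N) ≤
                    (1 + A * w N) * Hent σ a₀ θ₀ u₀ Rf ρ θ u N (Φ N) s + w N * ((N : ℝ) + 1) * ε) ∧
                (∀ s : ℝ, 0 ≤ s → s ≤ t → t ≤ s + w N →
                  Hent σ a₀ θ₀ u₀ Rf ρ θ u N (Φ N) t ≤ Hent σ a₀ θ₀ u₀ Rf ρ θ u N (Φ N) s + ((N : ℝ) + 1) * ε)

/-- **GRONWALL along the explicit reference, guarded** — `KL(law Λ_t ‖ localGibbsLaw σ (ρ_t Rf(σ³ρ_t)) u_t θ_t)/(N+1) → 0` for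
`t ∈ (0,T)` for Euler solutions whose packing stays below `ηg`: the first hypothesis of the Rf-dock (p120849) with the dilute
self-consistency premise REPLACED by the packing guard. -/
def GronwallRfLambdaInBand : Prop :=
  ∀ (r : ℝ) (Rf : ℝ → ℝ), 0 < r →
      (∀ x ∈ Set.Ioo (-r) r, 0 < Rf x ∧ Rf x * (∑' j : ℕ, bE j / (j.factorial : ℝ) * (x * Rf x) ^ j) = 1) →
      (∀ x ∈ Set.Icc 0 r, 1 ≤ Rf x ∧ Rf x ≤ 2) → ContinuousOn Rf (Set.Icc 0 r) →
      (∀ x ∈ Set.Ioo (-r) r, ∀ R ∈ Set.Icc (1 / 2 : ℝ) 2,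
        R * (∑' j : ℕ, bE j / (j.factorial : ℝ) * (x * R) ^ j) = 1 → R = Rf x) →
    ∃ ηg : ℝ, 0 < ηg ∧ ∀ (a₀ θ₀ : T3 → ℝ) (u₀ : T3 → V3), Continuous a₀ → Continuous θ₀ → Continuous u₀ →
      (∀ x, 0 < a₀ x) → (∀ x, 0 < θ₀ x) →
      ∃ σ₀ : ℝ, 0 < σ₀ ∧ ∀ σ : ℝ, 0 < σ → σ < σ₀ →
        ∀ (T : ℝ) (ρ θ : ℝ → T3 → ℝ) (u : ℝ → T3 → V3), IsHardSphereEulerSolution σ T ρ u θ →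
          (∀ t ∈ Set.Ico 0 T, ∀ x, ρ t x * σ ^ 3 < ηg) →
          ∀ Φ : (N : ℕ) → HardSphereFlow (Torus.geometry (Fin 3)) (hsDiameter σ N) (N + 1),
            TendstoHydroFieldsAt (fun N => localGibbsLaw σ a₀ u₀ θ₀ N (Φ N)) Φ ρ u θ 0 →
            ∀ t ∈ Set.Ioo 0 T,
              ∀ (hac : Continuous fun x => ρ t x * Rf (σ ^ 3 * ρ t x))
                (hap : ∀ x, 0 < ρ t x * Rf (σ ^ 3 * ρ t x)),
                (∀ x, ρ t x ≤ ρ t x * Rf (σ ^ 3 * ρ t x) ∧ ρ t x * Rf (σ ^ 3 * ρ t x) ≤ 2 * ρ t x) →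
                SmallDensity (profileOf (fun x => ρ t x * Rf (σ ^ 3 * ρ t x)) hac hap) σ →
                rhoLim (profileOf (fun x => ρ t x * Rf (σ ^ 3 * ρ t x)) hac hap) σ = ρ t →
                Tendsto (fun N : ℕ => klDiv (((localGibbsLaw σ a₀ u₀ θ₀ N (Φ N)).prod (lambertNoise (Fin 3))).map
                        (fun p => lambertFlow (Torus.geometry (Fin 3)) (hsDiameter σ N) p.2 p.1 t))
                  (localGibbsLaw σ (fun x => ρ t x * Rf (σ ^ 3 * ρ t x)) (u t) (θ t) N (Φ N)) / ((N : ℝ≥0∞) + 1)) atTop (𝓝 0)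

/-! ## §4 The packing-guarded crux -/

/-- **`LambertianEulerInBand` — EULER FOR THE LAMBERTIAN GAS, PACKING-GUARDED** (the crux `LambertianContactSwap.LambertianEuler` in the
shape of the re-typed summit conjunct `_root_.HydrodynamicLimit`, D-0032): there is a band `η₀ > 0` such that for all continuous positive
profiles there is `σ₀ > 0` such that for `0 < σ < σ₀`, every classical hs-Euler solution on `[0,T)` WHOSE PACKING `ρ_t σ³` STAYS BELOW
`η₀`, every flow family and local Gibbs data tied at `t = 0`: under `λ_N ⊗ γ^ℕ` the `χ`-tested empirical density, momentum and energy
fields of `Λ_{N,t}` (`lambertFlow`, noise `lambertNoise`) converge in probability to the Euler values for every `t < T`.  The unguarded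
crux is `LambertianEulerInBand` + `DiluteSelfConsistency` (`…OfHeartsInBand.lambertianEuler_of_inBand`); the line `Sketch` proves
`LambertianEulerInBand` from its two log-hearts alone (`…DockRfInBand.lambertianEulerInBand_of_hearts`).  OPEN — a research
statement of this line (the recommended re-typing of the crux), not a published fact. -/
def LambertianEulerInBand : Prop :=
  ∃ η₀ : ℝ, 0 < η₀ ∧ ∀ (a₀ θ₀ : T3 → ℝ) (u₀ : T3 → V3), Continuous a₀ → Continuous θ₀ → Continuous u₀ →
    (∀ x, 0 < a₀ x) → (∀ x, 0 < θ₀ x) →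
    ∃ σ₀ : ℝ, 0 < σ₀ ∧ ∀ σ : ℝ, 0 < σ → σ < σ₀ →
      ∀ (T : ℝ) (ρ θ : ℝ → T3 → ℝ) (u : ℝ → T3 → V3), IsHardSphereEulerSolution σ T ρ u θ →
        (∀ t ∈ Set.Ico 0 T, ∀ x, ρ t x * σ ^ 3 < η₀) →
        ∀ Φ : (N : ℕ) → HardSphereFlow (Torus.geometry (Fin 3)) (hsDiameter σ N) (N + 1),
          TendstoHydroFieldsAt (fun N => localGibbsLaw σ a₀ u₀ θ₀ N (Φ N)) Φ ρ u θ 0 →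
          ∀ t ∈ Set.Ico 0 T, ∀ χ : T3 → ℝ, Continuous χ → ∀ δ > (0 : ℝ),
            Tendsto (fun N : ℕ => ((localGibbsLaw σ a₀ u₀ θ₀ N (Φ N)).prod (lambertNoise (Fin 3)))
              {p | δ < |empiricalDensityField
                (lambertFlow (Torus.geometry (Fin 3)) (hsDiameter σ N) p.2 p.1 t) χ - ∫ x, χ x * ρ t x|}) atTop (𝓝 0) ∧
            Tendsto (fun N : ℕ => ((localGibbsLaw σ a₀ u₀ θ₀ N (Φ N)).prod (lambertNoise (Fin 3)))
              {p | δ < ‖empiricalMomentumField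
                (lambertFlow (Torus.geometry (Fin 3)) (hsDiameter σ N) p.2 p.1 t) χ - ∫ x, (χ x * ρ t x) • u t x‖})
              atTop (𝓝 0) ∧
            Tendsto (fun N : ℕ => ((localGibbsLaw σ a₀ u₀ θ₀ N (Φ N)).prod (lambertNoise (Fin 3)))
              {p | δ < |empiricalEnergyField
                (lambertFlow (Torus.geometry (Fin 3)) (hsDiameter σ N) p.2 p.1 t) χ -
                  ∫ x, χ x * totalEnergyDensity (ρ t x) (u t x) (θ t x)|}) atTop (𝓝 0)

end Summit.AtomisticToContinuum.HydrodynamicLimit.Theorems.LambertianContactSwapLambertianEulerHeartsLog
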